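import Summits.QuantumFields.YangMills.Theorems.AllWindowsColdBoxBoxHighLineRestrictionSetCum4Slots
import Summits.QuantumFields.YangMills.Theorems.AllWindowsColdBoxBoxHighLineConnectedFourPointCubicMuSet
import Summits.QuantumFields.YangMills.Theorems.AllWindowsColdBoxBoxHighLineTiltTruncation
import Summits.QuantumFields.YangMills.Theorems.AllWindowsColdBoxBoxHighLineGaussCovMainReduction

/-!
# U5 K4′(b): the ROW DECOMPOSITION of `κ₄,₀^{μ_{D′}}(X, Y; U)` — the composition (S1)∘(S2)∘(S3) of the K4′ term table as ONE inequality

Free-hands helper of LEAD ym-line-sfw-p2 g78 for Steps D–E of the NEXT rung U5 (`stub_landauThirdOrder`, LINE-20, ⟨stmt-QuantumFields-24336⟩); term table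
`ym-idea-1/g78-K4PRIME-TERM-TABLE.md` (evidence on ⟨24336⟩).  Over `μ_D := (volume.restrict D).withDensity (ofReal ∘ gaussWeight β H)` for a general measurable
`D` of positive Gaussian mass, and for measurable observables `X Y U P Lx Ly` bounded by `B` on `D` (together with `a ↦ U(−a)`), with the LETTERS OF RECORD
`Uᵒ a := (U a − U(−a))/2`, `Uᵉ a := (U a + U(−a))/2`, `N := Uᵒ − P`, `Q_x := X − Lx`, `Q_y := Y − Ly`:

* ★★ `GaussNormalForm.abs_tiltCum4_muSet_tiltU_le_rows` — the same in the hK4 LETTERS OF RECORD (w2 g33 ✓p753567): `X Y := chartPlaqCost · 1 2`,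
  `Lx Ly := linCurvSq (plaq12At ·)`, `U := tiltU β H` with `sup_D |tiltU| ≤ K` on a symmetric measurable `D ⊆ smallField H s`, `E₀[1 − 1_D] ≤ τ ≤ 1/2`, and
  `P := β·Σ_{p ∈ PT} tripleForm (Tc p) (plaqVar …)` for ANY `Tc` with `|Tc| ≤ B_T` (all boundedness / measurability obligations discharged).
* ★★ `GaussRestrict.abs_tiltCum4_muSet_zero_le_rows` —
  `|κ₄,₀(X,Y;U)| ≤ |κ₄,₀(Lx,Ly;P)| + |κ₄,₀(Q_x,Y;P) + κ₄,₀(Lx,Q_y;P)| + |κ₄,₀(X,Y;N)| + 2·|CROSS_P(X,Y;P,N)| + |κ₄,₀(X,Y;Uᵉ)| + 2·|CROSS_{Uᵒ}(X,Y;Uᵒ,Uᵉ)|`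
  (rows R1, R2, R3, R4, R5, R6+R7), every CROSS written VERBATIM as produced by fcl-p3 g27's ✓`tiltCum4_muSet_zero_add_third` with the tilt letter of the
  FIRST summand (`P`, resp. `Uᵒ`).  Pure slot calculus: `U = Uᵒ + Uᵉ` and `Uᵒ = P + N` through `add_third`, `X = Lx + Q_x`, `Y = Ly + Q_y` through `add_left/right`.
  The hK4 assembler instantiates `X Y := chartPlaqCost · 1 2`, `Lx Ly := linCurvSq (plaq12At ·)`, `U := tiltU β H`, `P := β·Σ_p tripleForm (Tc′ p) (plaqVar …)` with
  `Tc′ := −Tc` of ✓7a (so that `N = Uᵒ + P_{Tc}` is the small odd remainder `Gᵒ − R₅`), and adds the row bounds R1 ✓p753305, R2 (w5 g24), R3/R4 (w2 g33), R5 ✓(LEAD),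
  R6/R7 by the triangle inequality.

No definitions; standard axioms.  HONEST LABEL: helper-grade U5 prep; U5, ⟨24004⟩, ⟨24336⟩ remain OPEN; route AllWindowsColdBox is DRAFT; no crux, rung or summit is
proved; **the Yang–Mills mass gap is NOT proved by this file; no summit is proved by a line.**
-/

set_option autoImplicit false

noncomputable section

open MeasureTheory Set
open Literature.Probability.LatticeModels (Site)
open Literature.MathematicalPhysics.QuantumLattice (ZdPlaquette plaquettesTouching)
open Literature.MathematicalPhysics.QuantumFieldTheory.AxialGauge (boxEdges)
open Summit.QuantumFields.YangMills.Theorems.WeakCouplingRates (plaq12At)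

namespace Summit.QuantumFields.YangMills.Theorems.AllWindowsColdBoxBoxHighLine

namespace GaussRestrict

variable {H : ℕ} {β : ℝ}

/-- ★★ **Row decomposition of `κ₄,₀^{μ_D}(X,Y;U)`** (rows R1 … R7 of the K4′ term table), for observables measurable and bounded by `B` on `D`. -/
theorem abs_tiltCum4_muSet_zero_le_rows (hβ : 0 < β) {D : Set (LandauFree H → E3)} (hDm : MeasurableSet D)
    (hD : 0 < ∫ a, D.indicator (fun _ => (1 : ℝ)) a * gaussWeight β H a)
    {X Y U P Lx Ly : (LandauFree H → E3) → ℝ} {B : ℝ} (hB : 0 ≤ B)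
    (mX : Measurable X) (mY : Measurable Y) (mU : Measurable U) (mP : Measurable P) (mLx : Measurable Lx) (mLy : Measurable Ly)
    (bX : ∀ a ∈ D, |X a| ≤ B) (bY : ∀ a ∈ D, |Y a| ≤ B) (bU : ∀ a ∈ D, |U a| ≤ B) (bU' : ∀ a ∈ D, |U (-a)| ≤ B) (bP : ∀ a ∈ D, |P a| ≤ B)
    (bLx : ∀ a ∈ D, |Lx a| ≤ B) (bLy : ∀ a ∈ D, |Ly a| ≤ B) :
    let μD : Measure (LandauFree H → E3) := (((volume : Measure (LandauFree H → E3)).restrict D).withDensity fun a => ENNReal.ofReal (gaussWeight β H a))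
    let Uo : (LandauFree H → E3) → ℝ := fun a => (U a - U (-a)) / 2
    let Ue : (LandauFree H → E3) → ℝ := fun a => (U a + U (-a)) / 2
    let N : (LandauFree H → E3) → ℝ := fun a => (U a - U (-a)) / 2 - P a
    let EP : ((LandauFree H → E3) → ℝ) → ℝ := fun G => Tilt.tiltExp μD P 0 G
    let EO : ((LandauFree H → E3) → ℝ) → ℝ := fun G => Tilt.tiltExp μD Uo 0 G
    |Tilt.tiltCum4 μD U 0 X Y| ≤
      |Tilt.tiltCum4 μD P 0 Lx Ly| +
      |Tilt.tiltCum4 μD P 0 (fun a => X a - Lx a) Y + Tilt.tiltCum4 μD P 0 Lx (fun a => Y a - Ly a)| +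
      |Tilt.tiltCum4 μD N 0 X Y| +
      2 * |EP (fun a => (X a - EP X) * (Y a - EP Y) * (P a - EP P) * (N a - EP N)) - EP (fun a => (X a - EP X) * (Y a - EP Y)) * EP (fun a => (P a - EP P) * (N a - EP N))
          - EP (fun a => (X a - EP X) * (P a - EP P)) * EP (fun a => (Y a - EP Y) * (N a - EP N))
          - EP (fun a => (X a - EP X) * (N a - EP N)) * EP (fun a => (Y a - EP Y) * (P a - EP P))| +
      |Tilt.tiltCum4 μD Ue 0 X Y| +
      2 * |EO (fun a => (X a - EO X) * (Y a - EO Y) * (Uo a - EO Uo) * (Ue a - EO Ue)) - EO (fun a => (X a - EO X) * (Y a - EO Y)) * EO (fun a => (Uo a - EO Uo) * (Ue a - EO Ue))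
          - EO (fun a => (X a - EO X) * (Uo a - EO Uo)) * EO (fun a => (Y a - EO Y) * (Ue a - EO Ue))
          - EO (fun a => (X a - EO X) * (Ue a - EO Ue)) * EO (fun a => (Y a - EO Y) * (Uo a - EO Uo))| := by
  intro μD Uo Ue N EP EO
  -- bounds on `D` (everything by `2B`)
  have h2B : 0 ≤ 2 * B := by linarith
  have up : ∀ {G : (LandauFree H → E3) → ℝ}, (∀ a ∈ D, |G a| ≤ B) → ∀ a ∈ D, |G a| ≤ 2 * B := fun {G} h a ha => (h a ha).trans (by linarith)
  have bUo : ∀ a ∈ D, |Uo a| ≤ 2 * B := fun a ha => by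
    show |(U a - U (-a)) / 2| ≤ 2 * B
    rw [abs_div, abs_two]; linarith [abs_sub (U a) (U (-a)), bU a ha, bU' a ha]
  have bUe : ∀ a ∈ D, |Ue a| ≤ 2 * B := fun a ha => by
    show |(U a + U (-a)) / 2| ≤ 2 * B
    rw [abs_div, abs_two]; linarith [abs_add_le (U a) (U (-a)), bU a ha, bU' a ha]
  have bN : ∀ a ∈ D, |N a| ≤ 2 * B := fun a ha => by
    show |(U a - U (-a)) / 2 - P a| ≤ 2 * B
    have h1 : |(U a - U (-a)) / 2| ≤ B := by rw [abs_div, abs_two]; linarith [abs_sub (U a) (U (-a)), bU a ha, bU' a ha]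
    linarith [abs_sub ((U a - U (-a)) / 2) (P a), bP a ha]
  have bQx : ∀ a ∈ D, |X a - Lx a| ≤ 2 * B := fun a ha => by linarith [abs_sub (X a) (Lx a), bX a ha, bLx a ha]
  have bQy : ∀ a ∈ D, |Y a - Ly a| ≤ 2 * B := fun a ha => by linarith [abs_sub (Y a) (Ly a), bY a ha, bLy a ha]
  -- measurability
  have mneg : Measurable fun a : LandauFree H → E3 => U (-a) := mU.comp measurable_neg
  have mUo : Measurable Uo := (mU.sub mneg).div_const 2
  have mUe : Measurable Ue := (mU.add mneg).div_const 2
  have mN : Measurable N := ((mU.sub mneg).div_const 2).sub mP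
  have mQx : Measurable fun a => X a - Lx a := mX.sub mLx
  have mQy : Measurable fun a => Y a - Ly a := mY.sub mLy
  -- (S1) `U = Uᵒ + Uᵉ`
  have eU : (fun a => Uo a + Ue a) = U := funext fun a => by show (U a - U (-a)) / 2 + (U a + U (-a)) / 2 = U a; ring
  have s1 : Tilt.tiltCum4 μD U 0 X Y = Tilt.tiltCum4 μD (fun a => Uo a + Ue a) 0 X Y := by rw [eU]
  have h1 := tiltCum4_muSet_zero_add_third hβ hDm hD h2B mX mY mUo mUe (up bX) (up bY) bUo bUe
  dsimp only at h1
  -- (S2) `Uᵒ = P + N`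
  have eO : (fun a => P a + N a) = Uo := funext fun a => by show P a + ((U a - U (-a)) / 2 - P a) = (U a - U (-a)) / 2; ring
  have s2 : Tilt.tiltCum4 μD Uo 0 X Y = Tilt.tiltCum4 μD (fun a => P a + N a) 0 X Y := by rw [eO]
  have h2 := tiltCum4_muSet_zero_add_third hβ hDm hD h2B mX mY mP mN (up bX) (up bY) (up bP) bN
  dsimp only at h2
  -- (S3) `X = Lx + Q_x`, `Y = Ly + Q_y`
  have eX : (fun a => Lx a + (X a - Lx a)) = X := funext fun a => by ring
  have eY : (fun a => Ly a + (Y a - Ly a)) = Y := funext fun a => by ring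
  have s3 : Tilt.tiltCum4 μD P 0 X Y = Tilt.tiltCum4 μD P 0 (fun a => Lx a + (X a - Lx a)) Y := by rw [eX]
  have h3 := tiltCum4_muSet_zero_add_left hβ hDm hD P h2B mLx mQx mY mP (up bLx) bQx (up bY) (up bP)
  have s4 : Tilt.tiltCum4 μD P 0 Lx Y = Tilt.tiltCum4 μD P 0 Lx (fun a => Ly a + (Y a - Ly a)) := by rw [eY]
  have h4 := tiltCum4_muSet_zero_add_right hβ hDm hD P h2B mLx mLy mQy mP (up bLx) (up bLy) bQy (up bP)
  -- compose
  have key : Tilt.tiltCum4 μD U 0 X Y =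
      Tilt.tiltCum4 μD P 0 Lx Ly + (Tilt.tiltCum4 μD P 0 (fun a => X a - Lx a) Y + Tilt.tiltCum4 μD P 0 Lx (fun a => Y a - Ly a)) +
      Tilt.tiltCum4 μD N 0 X Y +
      2 * (EP (fun a => (X a - EP X) * (Y a - EP Y) * (P a - EP P) * (N a - EP N)) - EP (fun a => (X a - EP X) * (Y a - EP Y)) * EP (fun a => (P a - EP P) * (N a - EP N))
          - EP (fun a => (X a - EP X) * (P a - EP P)) * EP (fun a => (Y a - EP Y) * (N a - EP N))
          - EP (fun a => (X a - EP X) * (N a - EP N)) * EP (fun a => (Y a - EP Y) * (P a - EP P))) +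
      Tilt.tiltCum4 μD Ue 0 X Y +
      2 * (EO (fun a => (X a - EO X) * (Y a - EO Y) * (Uo a - EO Uo) * (Ue a - EO Ue)) - EO (fun a => (X a - EO X) * (Y a - EO Y)) * EO (fun a => (Uo a - EO Uo) * (Ue a - EO Ue))
          - EO (fun a => (X a - EO X) * (Uo a - EO Uo)) * EO (fun a => (Y a - EO Y) * (Ue a - EO Ue))
          - EO (fun a => (X a - EO X) * (Ue a - EO Ue)) * EO (fun a => (Y a - EO Y) * (Uo a - EO Uo))) := by
    rw [s1, h1, s2, h2, s3, h3, s4, h4]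
    ring
  rw [key]
  -- triangle inequality, six summands
  have tri : ∀ (a₁ a₂ a₃ c₄ a₅ c₆ : ℝ), |a₁ + a₂ + a₃ + 2 * c₄ + a₅ + 2 * c₆| ≤ |a₁| + |a₂| + |a₃| + 2 * |c₄| + |a₅| + 2 * |c₆| := by
    intro a₁ a₂ a₃ c₄ a₅ c₆
    have e4 : |2 * c₄| = 2 * |c₄| := by rw [abs_mul, abs_two]
    have e6 : |2 * c₆| = 2 * |c₆| := by rw [abs_mul, abs_two]
    linarith [abs_add_le (a₁ + a₂ + a₃ + 2 * c₄ + a₅) (2 * c₆), abs_add_le (a₁ + a₂ + a₃ + 2 * c₄) a₅, abs_add_le (a₁ + a₂ + a₃) (2 * c₄),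
      abs_add_le (a₁ + a₂) a₃, abs_add_le a₁ a₂]
  exact tri _ _ _ _ _ _

end GaussRestrict

/-! ## The hK4 letters of record -/

namespace GaussNormalForm

/-- ★★ **Row decomposition of `κ₄,₀^{μ_D}(chartPlaqCost x, chartPlaqCost y; tiltU)` in the hK4 letters of record**: `H ≥ 1`, `β > 0`, `0 ≤ s ≤ 1`, any `Tc` with
`|Tc| ≤ B_T`, a measurable symmetric `D ⊆ smallField H s` with `sup_D|tiltU| ≤ K`, `E₀[1 − 1_D] ≤ τ ≤ 1/2`; rows R1 … R7 with `P := β·Σ_p tripleForm (Tc p) (plaqVar …)`,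
`N := Uᵒ − P`, `Q_z := chartPlaqCost z 1 2 − linCurvSq (plaq12At z)`, `Uᵒ, Uᵉ` the parity parts of `tiltU`. -/
theorem abs_tiltCum4_muSet_tiltU_le_rows (H : ℕ) {β : ℝ} (hβ : 0 < β) {s : ℝ} (hs0 : 0 ≤ s) (hs1 : s ≤ 1)
    (BT : ℝ) (Tc : ZdPlaquette 4 → Fin 4 → Fin 4 → Fin 4 → ℝ) (hT : ∀ p i j k, |Tc p i j k| ≤ BT)
    {D : Set (LandauFree H → E3)} (hDm : MeasurableSet D) (hDs : D ⊆ smallField H s) (hsym : ∀ a, -a ∈ D ↔ a ∈ D)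
    {K : ℝ} (hK : 0 ≤ K) (hUK : ∀ a ∈ D, |tiltU β H a| ≤ K)
    {τ : ℝ} (hτ : gaussAvg β H (fun a => 1 - D.indicator (fun _ => (1 : ℝ)) a) ≤ τ) (hτ2 : τ ≤ 1 / 2) (x y : Site 4) :
    let μD : Measure (LandauFree H → E3) := (((volume : Measure (LandauFree H → E3)).restrict D).withDensity fun a => ENNReal.ofReal (gaussWeight β H a))
    let X : (LandauFree H → E3) → ℝ := chartPlaqCost H x 1 2
    let Y : (LandauFree H → E3) → ℝ := chartPlaqCost H y 1 2
    let U : (LandauFree H → E3) → ℝ := tiltU β H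
    let P : (LandauFree H → E3) → ℝ := fun a => β * ∑ p ∈ plaquettesTouching (boxEdges 4 (2 * H + 1)), tripleForm (Tc p) (plaqVar H p.1 p.2.1.1 p.2.1.2 a)
    let Lx : (LandauFree H → E3) → ℝ := linCurvSq H (plaq12At x)
    let Ly : (LandauFree H → E3) → ℝ := linCurvSq H (plaq12At y)
    let Uo : (LandauFree H → E3) → ℝ := fun a => (U a - U (-a)) / 2
    let Ue : (LandauFree H → E3) → ℝ := fun a => (U a + U (-a)) / 2
    let N : (LandauFree H → E3) → ℝ := fun a => (U a - U (-a)) / 2 - P a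
    let EP : ((LandauFree H → E3) → ℝ) → ℝ := fun G => Tilt.tiltExp μD P 0 G
    let EO : ((LandauFree H → E3) → ℝ) → ℝ := fun G => Tilt.tiltExp μD Uo 0 G
    |Tilt.tiltCum4 μD U 0 X Y| ≤
      |Tilt.tiltCum4 μD P 0 Lx Ly| +
      |Tilt.tiltCum4 μD P 0 (fun a => X a - Lx a) Y + Tilt.tiltCum4 μD P 0 Lx (fun a => Y a - Ly a)| +
      |Tilt.tiltCum4 μD N 0 X Y| +
      2 * |EP (fun a => (X a - EP X) * (Y a - EP Y) * (P a - EP P) * (N a - EP N)) - EP (fun a => (X a - EP X) * (Y a - EP Y)) * EP (fun a => (P a - EP P) * (N a - EP N))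
          - EP (fun a => (X a - EP X) * (P a - EP P)) * EP (fun a => (Y a - EP Y) * (N a - EP N))
          - EP (fun a => (X a - EP X) * (N a - EP N)) * EP (fun a => (Y a - EP Y) * (P a - EP P))| +
      |Tilt.tiltCum4 μD Ue 0 X Y| +
      2 * |EO (fun a => (X a - EO X) * (Y a - EO Y) * (Uo a - EO Uo) * (Ue a - EO Ue)) - EO (fun a => (X a - EO X) * (Y a - EO Y)) * EO (fun a => (Uo a - EO Uo) * (Ue a - EO Ue))
          - EO (fun a => (X a - EO X) * (Uo a - EO Uo)) * EO (fun a => (Y a - EO Y) * (Ue a - EO Ue))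
          - EO (fun a => (X a - EO X) * (Ue a - EO Ue)) * EO (fun a => (Y a - EO Y) * (Uo a - EO Uo))| := by
  intro μD X Y U P Lx Ly
  set PT := plaquettesTouching (boxEdges 4 (2 * H + 1)) with hPT
  have hD := GaussRestrict.integral_indicator_mul_gaussWeight_pos hβ hDm hτ hτ2
  -- one common bound on `D`
  set B : ℝ := 116 + 16 + K + |β * PT.card * (6 * BT * (4 * s) ^ 3)| with hB
  have hB0 : 0 ≤ B := by have := abs_nonneg (β * PT.card * (6 * BT * (4 * s) ^ 3)); rw [hB]; linarith
  have habs := abs_nonneg (β * PT.card * (6 * BT * (4 * s) ^ 3))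
  have hs2 : s ^ 2 ≤ 1 := pow_le_one₀ hs0 hs1
  have bX : ∀ z : Site 4, ∀ a ∈ D, |chartPlaqCost H z 1 2 a| ≤ B := fun z a ha =>
    (TiltSup.abs_chartPlaqCost_le hs0 hs1 (hDs ha) z 1 2).trans (by rw [hB]; nlinarith)
  have bL : ∀ z : Site 4, ∀ a ∈ D, |linCurvSq H (plaq12At z) a| ≤ B := fun z a ha => by
    have h1 : linCurvSq H (plaq12At z) a ≤ 16 * s ^ 2 := TiltSup.linCurvSq_le hs0 (hDs ha) z 1 2
    have h0 : 0 ≤ linCurvSq H (plaq12At z) a := Finset.sum_nonneg fun c _ => sq_nonneg _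
    rw [abs_of_nonneg h0, hB]; nlinarith
  have bU : ∀ a ∈ D, |U a| ≤ B := fun a ha => (hUK a ha).trans (by rw [hB]; linarith)
  have bU' : ∀ a ∈ D, |U (-a)| ≤ B := fun a ha => (hUK (-a) ((hsym a).2 ha)).trans (by rw [hB]; linarith)
  have bP : ∀ a ∈ D, |P a| ≤ B := by
    intro a ha
    show |β * ∑ p ∈ PT, tripleForm (Tc p) (plaqVar H p.1 p.2.1.1 p.2.1.2 a)| ≤ B
    rw [abs_mul, abs_of_pos hβ]
    have hterm : ∀ p ∈ PT, |tripleForm (Tc p) (plaqVar H p.1 p.2.1.1 p.2.1.2 a)| ≤ 6 * BT * (4 * s) ^ 3 := by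
      intro p _
      refine (EdgeChartGaussian.abs_tripleForm_le (Tc p) (hT p) _).trans ?_
      have hBT : 0 ≤ BT := (abs_nonneg _).trans (hT p 0 0 0)
      exact mul_le_mul_of_nonneg_left (pow_le_pow_left₀ (Finset.sum_nonneg fun i _ => norm_nonneg _)
        (TiltSup.sum_norm_plaqVar_le hs0 (hDs ha) p.1 p.2.1.1 p.2.1.2) 3) (by positivity)
    have hsum : |∑ p ∈ PT, tripleForm (Tc p) (plaqVar H p.1 p.2.1.1 p.2.1.2 a)| ≤ PT.card * (6 * BT * (4 * s) ^ 3) := by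
      refine (Finset.abs_sum_le_sum_abs _ _).trans ((Finset.sum_le_sum hterm).trans (le_of_eq ?_))
      rw [Finset.sum_const, nsmul_eq_mul]
    calc β * |∑ p ∈ PT, tripleForm (Tc p) (plaqVar H p.1 p.2.1.1 p.2.1.2 a)| ≤ β * (PT.card * (6 * BT * (4 * s) ^ 3)) :=
          mul_le_mul_of_nonneg_left hsum hβ.le
      _ = β * PT.card * (6 * BT * (4 * s) ^ 3) := by ring
      _ ≤ B := (le_abs_self _).trans (by rw [hB]; linarith)
  -- measurability
  have mP : Measurable P := EdgeChartGaussian.measurable_of_polyCert (EdgeChartGaussian.polyCert_tripleFormSum H β PT Tc hT)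
  exact GaussRestrict.abs_tiltCum4_muSet_zero_le_rows hβ hDm hD hB0 (EdgeChartGaussian.measurable_chartPlaqCost H x 1 2)
    (EdgeChartGaussian.measurable_chartPlaqCost H y 1 2) (measurable_tiltU β H) mP (EdgeChartGaussian.measurable_linCurvSq H (plaq12At x))
    (EdgeChartGaussian.measurable_linCurvSq H (plaq12At y)) (bX x) (bX y) bU bU' bP (bL x) (bL y)

end GaussNormalForm

end Summit.QuantumFields.YangMills.Theorems.AllWindowsColdBoxBoxHighLine

end
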